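import Literature.Topology.FourManifolds.SphereSurgeryHomology
import Literature.Topology.FourManifolds.SphereProductSlicesMixed
import HarnessLib

/-!
# Surgery in the middle dimension, I: the meridian of the torus and the vanishing of `Hₗ`
# of the surgered manifold (Kervaire–Milnor 1963, Lemma 5.6 and p. 527)

Topic `Literature/Topology/FourManifolds`; companion of `SphereSurgeryHomology.lean` (the
homology of a surgery BELOW the middle dimension, Kosinski X.1.1) on the way to the surgical step
of M. Kervaire, J. Milnor, *Groups of homotopy spheres I*, Ann. of Math. 77 (1963), Lemma 7.1
(pp. 526–528; tree: hypothesis `h71` of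
`HomotopySphere.mk_eq_mk_iff_sigmaGen_dvd_sub_of_lemma71`, `HomotopySpheresSignatureLemma71.lean`,
under the named fact `Literature.Topology.FourManifolds.HomotopySphere.mk_eq_mk_iff_sigmaGen_dvd_sub`,
Thm. 7.5). Everything here is **proved**; the only definitions (with bodies) are explicit maps
of the model pieces; no named fact is introduced (D-0026).

Setting (as in `SphereSurgeryHomology.lean`): `ν` a framed family with ONE sphere `Sᵏ` and fibre
`ℝˡ⁺¹` in a Hausdorff `X`, and `P` glued from `A = X ∖ S` and the handle `B = OD^{k+1} × Sˡ`
by open embeddings `jA`, `jB` covering `P` along Milnor's relation (`hA hB hcov hrel`). The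
Mayer–Vietoris sequence of `P = jA(A) ∪ jB(B)` has `jA(A) ∩ jB(B) ≅ Sᵏ × (Bˡ⁺¹ ∖ 0)`, the
punctured tube — Kervaire–Milnor's "torus" `φ(Sᵏ × Sˡ)` up to homotopy (p. 515: the classes
`ε'` of the meridian `φ(x₀ × Sˡ)` and `ε` of the parallel `φ(Sᵏ × x₀)`).

* `isZero_of_mayerVietoris_of_map_eq_zero` — **a Mayer–Vietoris vanishing criterion**: for an
  open cover `P = U ∪ V`, if both inclusions `Hₙ₊₁(U) → Hₙ₊₁(P)`, `Hₙ₊₁(V) → Hₙ₊₁(P)` vanish and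
  `φ : Hₙ(U ∩ V) → Hₙ(U) ⊕ Hₙ(V)` is injective, then `Hₙ₊₁(P) = 0`;
  `map_subsetIncl_right_eq_zero_of_epi` — if `Hₙ₊₁(U) → Hₙ₊₁(P)` vanishes and
  `Hₙ₊₁(U ∩ V) → Hₙ₊₁(V)` is onto then `Hₙ₊₁(V) → Hₙ₊₁(P)` vanishes too (Hatcher 2002, §2.2).
* `FramedSphereFamily.tubeRetraction` — the radial homotopy equivalence
  `Sᵏ × (Bˡ⁺¹ ∖ 0) ≃ₕ Sᵏ × Sˡ`, `(u, w) ↦ (u, w/‖w‖)`; `meridianPT u₀ : Sˡ → Sᵏ × (Bˡ⁺¹ ∖ 0)`,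
  `v ↦ (u₀, v/2)`, and `parallelPT : Sᵏ → Sᵏ × (Bˡ⁺¹ ∖ 0)`, `u ↦ (u, v₀)`;
  **`(meridianPT)_* : Hₗ(Sˡ) ≅ Hₗ(Sᵏ × (Bˡ⁺¹ ∖ 0))`** and **`(parallelPT)_* : Hₖ(Sᵏ) ≅ Hₖ(…)`**
  for `k ≠ l`, `k, l ≥ 2` (`isIso_map_meridianPT`, `isIso_map_parallelPT`; from
  `SphereProductSlicesMixed.lean`).
* `FramedSphereFamily.glueMapPT` — Milnor's identification `(u, w) ↦ (‖w‖ u, w/‖w‖)` of the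
  punctured tube with the punctured handle, and `isIso_map_glueMapPT`:
  **`Hₗ(Sᵏ × (Bˡ⁺¹ ∖ 0)) ≅ Hₗ(OD^{k+1} × Sˡ)`** (the meridian goes to the core sphere of the
  handle; Kervaire–Milnor p. 516, "`ε'`… the homology class of the meridian");
  transported to `P`: `isIso_map_inter_right` — `Hₗ(jA(A) ∩ jB(B)) ≅ Hₗ(jB(B))`.
* `FramedSphereFamily.isZero_singularHomology_of_middleSurgery_of_epi` — **`Hₗ(P) = 0` for a
  surgery on `Sᵏ ⊂ X` with fibre `ℝˡ⁺¹`, `2 ≤ l < k`, `k ≠ l` (in particular `k = l + 1 ≥ 3`, the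
  middle dimension of the `2k`-manifold `X`), provided `Hₗ(X) = 0` and
  `Hₗ₊₁(X) → Hₗ₊₁(X, X ∖ S)` is onto** — the
  homological form of Kervaire–Milnor's "since `μ·λ = 1` it follows that `Hₖ₋₁M₀ = 0`. From
  this fact one easily proves that `M₀` and `M'` are `(k-1)`-connected" (p. 527; Kosinski 1993,
  X.1, Prop. (1.3): surgery on a primitive class): `Hₗ(X ∖ S) = 0` by the exact sequence of the
  pair, the handle's `Hₗ` is fed by the meridian, which comes from `X ∖ S`, and
  `Hₗ₋₁(jA(A) ∩ jB(B)) → Hₗ₋₁(jA(A))` is injective (`mono_map_inter`).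

## References

* M. Kervaire, J. Milnor, *Groups of homotopy spheres I*, Ann. of Math. 77 (1963), Lemma 5.6
  (pp. 514–516), Lemma 7.1 (pp. 526–528). [KervaireMilnorAnnals1963]
* A. Kosinski, *Differential Manifolds* (1993), Ch. X §1, Prop. (1.3) and pp. 198–199.
  [Kosinski1993]
* A. Hatcher, *Algebraic Topology* (2002), §2.2 pp. 149–150 (Mayer–Vietoris), Thm. 2.16,
  Cor. 2.11. [HatcherAT2002]
-/

noncomputable section

open scoped Manifold ContDiff Topology ContinuousMap
open CategoryTheory Limits Set Function Metric Topology
open Literature.AlgebraicTopology.SingularHomology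

universe u v

namespace Literature.Topology.FourManifolds

/-- Local notation: `𝔼 n` is the model Euclidean space `EuclideanSpace ℝ (Fin n)`. -/
local notation "𝔼 " n:arg => EuclideanSpace ℝ (Fin n)

/-- Local notation: `𝕊 n` is the unit sphere in `EuclideanSpace ℝ (Fin (n + 1))`. -/
local notation "𝕊 " n:arg => (Metric.sphere (0 : EuclideanSpace ℝ (Fin (n + 1))) 1)

/-! ### Two more Mayer–Vietoris criteria (Hatcher §2.2) -/

section MV

variable {P : Type u} [TopologicalSpace P] (U V : Set P)

/-- `φ : Hₙ(U ∩ V) → Hₙ(U) ⊕ Hₙ(V)` is injective as soon as its `V`-component is. [folklore] -/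
theorem mono_mayerVietoris_φ_of_mono_right (n : ℕ)
    (hmono : Mono (singularHomology.map ℤ ℤ
      (subsetInclusion (inter_subset_right : U ∩ V ⊆ V)) n)) :
    Mono (mayerVietoris.φ ℤ ℤ U V n) :=
  mono_of_mono_fac (show mayerVietoris.φ ℤ ℤ U V n ≫ (-biprod.snd) = singularHomology.map ℤ ℤ
      (subsetInclusion (inter_subset_right : U ∩ V ⊆ V)) n by
    rw [Preadditive.comp_neg, mayerVietoris.φ, biprod.lift_snd, neg_neg])

/-- `φ : Hₙ(U ∩ V) → Hₙ(U) ⊕ Hₙ(V)` is injective as soon as its `U`-component is. [folklore] -/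
theorem mono_mayerVietoris_φ_of_mono_left (n : ℕ)
    (hmono : Mono (singularHomology.map ℤ ℤ
      (subsetInclusion (inter_subset_left : U ∩ V ⊆ U)) n)) :
    Mono (mayerVietoris.φ ℤ ℤ U V n) :=
  mono_of_mono_fac (biprod.lift_fst _ _ : mayerVietoris.φ ℤ ℤ U V n ≫ biprod.fst = _)

/-- **If `Hₙ₊₁(U)` dies in `P` and `Hₙ₊₁(U ∩ V) → Hₙ₊₁(V)` is onto then `Hₙ₊₁(V)` dies in `P`**:
`i_V ≫ j_V = i_U ≫ j_U` (`φ ≫ ψ = 0`), and `i_V` is onto. [cite: HatcherAT2002, §2.2 p. 149] -/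
theorem map_subsetIncl_right_eq_zero_of_epi (n : ℕ)
    (hjU : singularHomology.map ℤ ℤ (subsetIncl U) (n + 1) = 0)
    (hepi : Epi (singularHomology.map ℤ ℤ
      (subsetInclusion (inter_subset_right : U ∩ V ⊆ V)) (n + 1))) :
    singularHomology.map ℤ ℤ (subsetIncl V) (n + 1) = 0 := by
  have hφψ := mayerVietoris.φ_comp_ψ ℤ ℤ U V (n + 1)
  rw [mayerVietoris.φ, mayerVietoris.ψ, biprod.lift_desc, Preadditive.neg_comp, ← sub_eq_add_neg,
    sub_eq_zero, ← singularHomology.map_comp, ← singularHomology.map_comp] at hφψ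
  -- `hφψ : (U ∩ V → U → P)_* = (U ∩ V → V → P)_*`
  have h1 : singularHomology.map ℤ ℤ ((subsetIncl U).comp
      (subsetInclusion (inter_subset_left : U ∩ V ⊆ U))) (n + 1) = 0 := by
    rw [singularHomology.map_comp, hjU, comp_zero]
  rw [h1, singularHomology.map_comp] at hφψ
  rw [← cancel_epi (singularHomology.map ℤ ℤ
    (subsetInclusion (inter_subset_right : U ∩ V ⊆ V)) (n + 1)), ← hφψ, comp_zero]

/-- **Mayer–Vietoris vanishing criterion**: for an open cover `P = U ∪ V`, if both
`Hₙ₊₁(U) → Hₙ₊₁(P)` and `Hₙ₊₁(V) → Hₙ₊₁(P)` vanish and `φ : Hₙ(U ∩ V) → Hₙ(U) ⊕ Hₙ(V)` is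
injective (so that the connecting map `Hₙ₊₁(P) → Hₙ(U ∩ V)` vanishes and `ψ` is onto), then
`Hₙ₊₁(P) = 0` (Hatcher 2002, §2.2 p. 149). [cite: HatcherAT2002, §2.2 p. 149] -/
theorem isZero_of_mayerVietoris_of_map_eq_zero (hU : IsOpen U) (hV : IsOpen V)
    (hUV : U ∪ V = univ) (n : ℕ)
    (hjU : singularHomology.map ℤ ℤ (subsetIncl U) (n + 1) = 0)
    (hjV : singularHomology.map ℤ ℤ (subsetIncl V) (n + 1) = 0)
    (hmono : Mono (mayerVietoris.φ ℤ ℤ U V n)) :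
    IsZero (singularHomology ℤ ℤ P (n + 1)) := by
  have hUV' : interior U ∪ interior V = univ := by rw [hU.interior_eq, hV.interior_eq, hUV]
  have hexc := relativeSingularHomology.isIso_map_of_interior_union_interior_holds ℤ ℤ P
  have hδ : mayerVietoris.δ ℤ ℤ U V hexc hUV' n = 0 :=
    zero_of_comp_mono (mayerVietoris.φ ℤ ℤ U V n) (mayerVietoris.δ_comp_φ ℤ ℤ U V hexc hUV' n)
  have hψepi : Epi (mayerVietoris.ψ ℤ ℤ U V (n + 1)) :=
    (mayerVietoris.exact₂_holds ℤ ℤ U V hexc hUV' n).epi_f hδ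
  have hψ0 : mayerVietoris.ψ ℤ ℤ U V (n + 1) = 0 := by
    apply biprod.hom_ext'
    · rw [mayerVietoris.ψ, biprod.inl_desc, hjU, comp_zero]
    · rw [mayerVietoris.ψ, biprod.inr_desc, hjV, comp_zero]
  rw [hψ0] at hψepi
  exact IsZero.of_epi_zero (singularHomology ℤ ℤ ↥U (n + 1) ⊞ singularHomology ℤ ℤ ↥V (n + 1)) _

end MV

/-! ### The punctured tube `Sᵏ × (Bˡ⁺¹ ∖ 0)`: radial retraction, meridian and parallel -/

namespace FramedSphereFamily

section Tube

variable {k l : ℕ}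

/-- A positive multiple of a non-zero vector of the open unit ball, of norm `< 1`, lies in the
punctured unit tube fibre. [folklore] -/
theorem smul_mem_puncturedBall {w : 𝔼 (l + 1)} (hw : w ≠ 0) {c : ℝ} (hc : 0 < c)
    (hc1 : c * ‖w‖ < 1) : c • w ≠ 0 ∧ ‖c • w‖ < 1 :=
  ⟨smul_ne_zero hc.ne' hw, by rwa [norm_smul, Real.norm_of_nonneg hc.le]⟩

/-- The radial retraction `(u, w) ↦ (u, w/‖w‖)` of the punctured tube onto `Sᵏ × Sˡ`.
[cite: KervaireMilnorAnnals1963, Lemma 5.6, proof (p. 515)] -/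
def tubeRetractionFun (k l : ℕ) : C(↥(puncturedUnitTube k l), (𝕊 k) × (𝕊 l)) :=
  ⟨fun q => (q.1.1, radialProjection (spherePt l) q.1.2),
    (continuous_fst.comp continuous_subtype_val).prodMk
      ((continuousOn_radialProjection (spherePt l)).comp_continuous
        (continuous_snd.comp continuous_subtype_val) fun q => q.2.1)⟩

/-- The values of the radial retraction. [folklore] -/
@[simp] theorem tubeRetractionFun_apply (q : ↥(puncturedUnitTube k l)) :
    tubeRetractionFun k l q = (q.1.1, radialProjection (spherePt l) q.1.2) := rfl

/-- The section `(u, v) ↦ (u, v/2)` of the radial retraction (the torus of radius `½` in the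
punctured tube). [cite: KervaireMilnorAnnals1963, Lemma 5.6, proof (p. 515)] -/
def tubeSection (k l : ℕ) : C((𝕊 k) × (𝕊 l), ↥(puncturedUnitTube k l)) :=
  ⟨fun p => ⟨(p.1, (2⁻¹ : ℝ) • (p.2 : 𝔼 (l + 1))),
      ⟨smul_ne_zero (by norm_num) (ne_zero_of_mem_unit_sphere p.2),
        by rw [norm_smul_coe_sphere (by norm_num : (0 : ℝ) ≤ 2⁻¹)]; norm_num⟩⟩,
    Continuous.subtype_mk (by fun_prop) _⟩

/-- The values of the section. [folklore] -/
@[simp] theorem tubeSection_apply_coe (p : (𝕊 k) × (𝕊 l)) :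
    ((tubeSection k l p : ↥(puncturedUnitTube k l)) : (𝕊 k) × (𝔼 (l + 1))) =
      (p.1, (2⁻¹ : ℝ) • (p.2 : 𝔼 (l + 1))) := rfl

/-- The radial retraction is a left inverse of the section: `(u, (v/2)/‖v/2‖) = (u, v)`.
[folklore] -/
theorem tubeRetractionFun_comp_tubeSection :
    (tubeRetractionFun k l).comp (tubeSection k l) = ContinuousMap.id _ := by
  ext p
  · rfl
  · show ((radialProjection (spherePt l) ((2⁻¹ : ℝ) • (p.2 : 𝔼 (l + 1))) : 𝕊 l) : 𝔼 (l + 1)) _ = _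
    rw [radialProjection_smul _ (by norm_num : (0 : ℝ) < 2⁻¹)]
    rfl

/-- The straight-line homotopy in the fibre from `section ∘ retraction` to the identity of the
punctured tube: `(t, (u, w)) ↦ (u, ((1 - t)/(2‖w‖) + t) w)`. [folklore] -/
def tubeHomotopy (k l : ℕ) :
    ContinuousMap.Homotopy ((tubeSection k l).comp (tubeRetractionFun k l)) (ContinuousMap.id _) where
  toFun p := ⟨(p.2.1.1, ((1 - (p.1 : ℝ)) * (2⁻¹ * ‖p.2.1.2‖⁻¹) + (p.1 : ℝ)) • p.2.1.2), by
    obtain ⟨hw0, hw1⟩ := p.2.2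
    have ht0 : 0 ≤ (p.1 : ℝ) := p.1.2.1
    have ht1 : (p.1 : ℝ) ≤ 1 := p.1.2.2
    have hn : 0 < ‖p.2.1.2‖ := norm_pos_iff.2 hw0
    refine smul_mem_puncturedBall hw0 ?_ ?_
    · rcases eq_or_lt_of_le ht1 with h1 | h1
      · rw [h1]; norm_num
      · have : 0 < (1 - (p.1 : ℝ)) * (2⁻¹ * ‖p.2.1.2‖⁻¹) := by
          apply mul_pos (by linarith); positivity
        linarith
    · have hrw : ((1 - (p.1 : ℝ)) * (2⁻¹ * ‖p.2.1.2‖⁻¹) + (p.1 : ℝ)) * ‖p.2.1.2‖ =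
          (1 - (p.1 : ℝ)) * 2⁻¹ + (p.1 : ℝ) * ‖p.2.1.2‖ := by
        field_simp
      rw [hrw]
      rcases eq_or_lt_of_le ht1 with h1 | h1
      · rw [h1]; simpa using hw1
      · nlinarith⟩
  continuous_toFun := by
    have hw : Continuous fun p : unitInterval × ↥(puncturedUnitTube k l) => p.2.1.2 :=
      continuous_snd.comp (continuous_subtype_val.comp continuous_snd)
    have hu : Continuous fun p : unitInterval × ↥(puncturedUnitTube k l) => p.2.1.1 :=
      continuous_fst.comp (continuous_subtype_val.comp continuous_snd)
    have hc : Continuous fun p : unitInterval × ↥(puncturedUnitTube k l) =>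
        (1 - (p.1 : ℝ)) * (2⁻¹ * ‖p.2.1.2‖⁻¹) + (p.1 : ℝ) :=
      ((continuous_const.sub (continuous_subtype_val.comp continuous_fst)).mul
        (continuous_const.mul ((continuous_norm.comp hw).inv₀ fun p =>
          norm_ne_zero_iff.2 p.2.2.1))).add (continuous_subtype_val.comp continuous_fst)
    exact Continuous.subtype_mk (hu.prodMk (hc.smul hw)) _
  map_zero_left q := by
    apply Subtype.ext
    apply Prod.ext
    · rfl
    · show ((1 - (0 : ℝ)) * (2⁻¹ * ‖q.1.2‖⁻¹) + 0) • q.1.2 =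
        (2⁻¹ : ℝ) • ((radialProjection (spherePt l) q.1.2 : 𝕊 l) : 𝔼 (l + 1))
      rw [coe_radialProjection_of_ne_zero _ q.2.1, smul_smul]
      norm_num
  map_one_left q := by
    apply Subtype.ext
    apply Prod.ext
    · rfl
    · show ((1 - (1 : ℝ)) * (2⁻¹ * ‖q.1.2‖⁻¹) + 1) • q.1.2 = q.1.2
      simp

/-- **The radial homotopy equivalence `Sᵏ × (Bˡ⁺¹ ∖ 0) ≃ₕ Sᵏ × Sˡ`**, `(u, w) ↦ (u, w/‖w‖)`, with
homotopy inverse `(u, v) ↦ (u, v/2)` and the straight-line homotopy in the fibre (Kervaire–Milnor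
1963, p. 515: the "torus" `φ(Sᵏ × Sˡ)` inside the punctured tube). [cite: KervaireMilnorAnnals1963, Lemma 5.6, proof (p. 515)] -/
def tubeRetraction (k l : ℕ) :
    ContinuousMap.HomotopyEquiv ↥(puncturedUnitTube k l) ((𝕊 k) × (𝕊 l)) where
  toFun := tubeRetractionFun k l
  invFun := tubeSection k l
  left_inv := ⟨tubeHomotopy k l⟩
  right_inv := by
    rw [tubeRetractionFun_comp_tubeSection]

/-- The forward map of the radial homotopy equivalence is the radial retraction. [folklore] -/
@[simp] theorem tubeRetraction_toFun : (tubeRetraction k l).toFun = tubeRetractionFun k l := rfl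

/-- **The meridian** `v ↦ (u₀, v/2)` of the punctured tube (Kervaire–Milnor 1963, p. 516: the
"meridian" `φ(x₀ × Sˡ)` of the torus). [cite: KervaireMilnorAnnals1963, Lemma 5.6, proof (p. 516)] -/
def meridianPT (u₀ : 𝕊 k) : C(𝕊 l, ↥(puncturedUnitTube k l)) :=
  ⟨fun v => ⟨(u₀, (2⁻¹ : ℝ) • (v : 𝔼 (l + 1))),
      ⟨smul_ne_zero (by norm_num) (ne_zero_of_mem_unit_sphere v),
        by rw [norm_smul_coe_sphere (by norm_num : (0 : ℝ) ≤ 2⁻¹)]; norm_num⟩⟩,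
    Continuous.subtype_mk (by fun_prop) _⟩

/-- **The parallel** `u ↦ (u, v₀)` of the punctured tube, `0 < ‖v₀‖ < 1` (Kervaire–Milnor 1963,
p. 516: the "parallel" `φ(Sᵏ × x₀)` of the torus; `SphereSurgeryHomology.parallelSphere` is its
image in `X ∖ S`). [cite: KervaireMilnorAnnals1963, Lemma 5.6, proof (p. 516)] -/
def parallelPT {v₀ : 𝔼 (l + 1)} (hv₀ : v₀ ≠ 0) (hv₁ : ‖v₀‖ < 1) :
    C(𝕊 k, ↥(puncturedUnitTube k l)) :=
  ⟨fun u => ⟨(u, v₀), ⟨hv₀, hv₁⟩⟩, (continuous_id.prodMk continuous_const).subtype_mk _⟩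

/-- Under the radial retraction the meridian is the vertical slice `v ↦ (u₀, v)` of `Sᵏ × Sˡ`.
[folklore] -/
theorem tubeRetractionFun_comp_meridianPT (u₀ : 𝕊 k) :
    (tubeRetractionFun k l).comp (meridianPT u₀) =
      (⟨fun v => (u₀, v), by fun_prop⟩ : C(𝕊 l, (𝕊 k) × (𝕊 l))) := by
  ext v
  · rfl
  · show ((radialProjection (spherePt l) ((2⁻¹ : ℝ) • (v : 𝔼 (l + 1))) : 𝕊 l) : 𝔼 (l + 1)) _ = _
    rw [radialProjection_smul _ (by norm_num : (0 : ℝ) < 2⁻¹)]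
    rfl

/-- Under the radial retraction the parallel is the horizontal slice `u ↦ (u, v₀/‖v₀‖)`.
[folklore] -/
theorem tubeRetractionFun_comp_parallelPT {v₀ : 𝔼 (l + 1)} (hv₀ : v₀ ≠ 0) (hv₁ : ‖v₀‖ < 1) :
    (tubeRetractionFun k l).comp (parallelPT (k := k) hv₀ hv₁) =
      (⟨fun u => (u, radialProjection (spherePt l) v₀), by fun_prop⟩ : C(𝕊 k, (𝕊 k) × (𝕊 l))) := by
  ext u <;> rfl

/-- A homotopy equivalence induces isomorphisms on singular homology (Hatcher 2002, Cor. 2.11).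
[cite: HatcherAT2002, Cor. 2.11] -/
theorem isIso_map_homotopyEquiv_toFun {C Y : Type} [TopologicalSpace C] [TopologicalSpace Y]
    (e : ContinuousMap.HomotopyEquiv C Y) (j : ℕ) : IsIso (singularHomology.map ℤ ℤ e.toFun j) := by
  refine ⟨⟨singularHomology.map ℤ ℤ e.invFun j, ?_, ?_⟩⟩
  · rw [← singularHomology.map_comp, singularHomology.map_eq_of_homotopic ℤ ℤ e.left_inv j,
      singularHomology.map_id]
  · rw [← singularHomology.map_comp, singularHomology.map_eq_of_homotopic ℤ ℤ e.right_inv j,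
      singularHomology.map_id]

/-- **The meridian generates `Hₗ` of the punctured tube**: `(meridianPT u₀)_* : Hₗ(Sˡ) ≅
Hₗ(Sᵏ × (Bˡ⁺¹ ∖ 0))` for `k ≠ l`, `k, l ≥ 2` (radial retraction onto `Sᵏ × Sˡ` and the vertical
slice isomorphism `isIso_map_vertSliceMixed`). [cite: KervaireMilnorAnnals1963, Lemma 5.6, proof (p. 516)] [cite: HatcherAT2002, Thm. 3B.6] -/
theorem isIso_map_meridianPT (hk : 2 ≤ k) (hl : 2 ≤ l) (hkl : k ≠ l) (u₀ : 𝕊 k) :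
    IsIso (singularHomology.map ℤ ℤ (meridianPT (k := k) (l := l) u₀) l) := by
  haveI h1 : IsIso (singularHomology.map ℤ ℤ (tubeRetractionFun k l) l) :=
    isIso_map_homotopyEquiv_toFun (tubeRetraction k l) l
  haveI h2 : IsIso (singularHomology.map ℤ ℤ ((tubeRetractionFun k l).comp (meridianPT u₀)) l) := by
    rw [tubeRetractionFun_comp_meridianPT]
    exact isIso_map_vertSliceMixed hk hl hkl u₀
  rw [singularHomology.map_comp] at h2
  exact IsIso.of_isIso_comp_right (singularHomology.map ℤ ℤ (meridianPT u₀) l)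
    (singularHomology.map ℤ ℤ (tubeRetractionFun k l) l)

/-- **The parallel generates `Hₖ` of the punctured tube**: `(parallelPT)_* : Hₖ(Sᵏ) ≅
Hₖ(Sᵏ × (Bˡ⁺¹ ∖ 0))` for `k ≠ l`, `k, l ≥ 2`. [cite: KervaireMilnorAnnals1963, Lemma 5.6, proof (p. 516)] [cite: HatcherAT2002, Thm. 3B.6] -/
theorem isIso_map_parallelPT (hk : 2 ≤ k) (hl : 2 ≤ l) (hkl : k ≠ l) {v₀ : 𝔼 (l + 1)}
    (hv₀ : v₀ ≠ 0) (hv₁ : ‖v₀‖ < 1) :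
    IsIso (singularHomology.map ℤ ℤ (parallelPT (k := k) hv₀ hv₁) k) := by
  haveI h1 : IsIso (singularHomology.map ℤ ℤ (tubeRetractionFun k l) k) :=
    isIso_map_homotopyEquiv_toFun (tubeRetraction k l) k
  haveI h2 : IsIso (singularHomology.map ℤ ℤ
      ((tubeRetractionFun k l).comp (parallelPT (k := k) hv₀ hv₁)) k) := by
    rw [tubeRetractionFun_comp_parallelPT]
    exact isIso_map_horizSliceMixed hk hl hkl _
  rw [singularHomology.map_comp] at h2
  exact IsIso.of_isIso_comp_right (singularHomology.map ℤ ℤ (parallelPT (k := k) hv₀ hv₁) k)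
    (singularHomology.map ℤ ℤ (tubeRetractionFun k l) k)

/-- The projection of the punctured tube to the fibre direction, `(u, w) ↦ w/‖w‖`, is an
isomorphism on `Hₗ` (`k ≠ l`, `k, l ≥ 2`): it is `pr₂ ∘` (radial retraction).
[cite: HatcherAT2002, Thm. 3B.6] -/
theorem isIso_map_sndRadial (hk : 2 ≤ k) (hl : 2 ≤ l) (hkl : k ≠ l) :
    IsIso (singularHomology.map ℤ ℤ
      ((ContinuousMap.snd : C((𝕊 k) × (𝕊 l), 𝕊 l)).comp (tubeRetractionFun k l)) l) := by
  haveI : IsIso (singularHomology.map ℤ ℤ (tubeRetractionFun k l) l) :=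
    isIso_map_homotopyEquiv_toFun (tubeRetraction k l) l
  haveI := isIso_map_sndMixed hk hl hkl
  rw [singularHomology.map_comp]
  infer_instance

/-- The projection of the punctured tube to the sphere direction, `(u, w) ↦ u`, is an
isomorphism on `Hₖ` (`k ≠ l`, `k, l ≥ 2`). [cite: HatcherAT2002, Thm. 3B.6] -/
theorem isIso_map_fstTube (hk : 2 ≤ k) (hl : 2 ≤ l) (hkl : k ≠ l) :
    IsIso (singularHomology.map ℤ ℤ
      ((ContinuousMap.fst : C((𝕊 k) × (𝕊 l), 𝕊 k)).comp (tubeRetractionFun k l)) k) := by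
  haveI : IsIso (singularHomology.map ℤ ℤ (tubeRetractionFun k l) k) :=
    isIso_map_homotopyEquiv_toFun (tubeRetraction k l) k
  haveI := isIso_map_fstMixed hk hl hkl
  rw [singularHomology.map_comp]
  infer_instance

/-! ### Milnor's identification of the punctured tube with the punctured handle -/

/-- **Milnor's identification** `φ(u, w) ∼ (‖w‖ u, w/‖w‖)` as a map from the punctured tube
`Sᵏ × (Bˡ⁺¹ ∖ 0)` to the handle `ι × OD^{k+1} × Sˡ` (one index), Milnor 1965, Def. 3.11:
"identifying `φ(u, θv)` with `(θu, v)`". [cite: MilnorHCobordism1965, Def. 3.11 (PDF p. 17)] -/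
def glueMapPT (ι : Type) [Unique ι] (k l : ℕ) :
    C(↥(puncturedUnitTube k l), ↥(ballTimesSphere ι k l)) where
  toFun q := ⟨(DiscreteIndex.mk default,
      (‖q.1.2‖ • (q.1.1 : 𝔼 (k + 1)), radialProjection (spherePt l) q.1.2)), by
    rw [mem_ballTimesSphere_iff, norm_smul_coe_sphere (norm_nonneg _)]; exact q.2.2⟩
  continuous_toFun := by
    refine Continuous.subtype_mk (continuous_const.prodMk (Continuous.prodMk ?_ ?_)) _
    · exact ((continuous_norm.comp (continuous_snd.comp continuous_subtype_val)).smul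
        (continuous_subtype_val.comp (continuous_fst.comp continuous_subtype_val)))
    · exact (continuousOn_radialProjection (spherePt l)).comp_continuous
        (continuous_snd.comp continuous_subtype_val) fun q => q.2.1

/-- The projection of the one-index handle `ι × OD^{k+1} × Sˡ` onto `Sˡ`. [folklore] -/
def handleProj (ι : Type) (k l : ℕ) : C(↥(ballTimesSphere ι k l), 𝕊 l) :=
  ⟨fun b => b.1.2.2, continuous_snd.comp (continuous_snd.comp continuous_subtype_val)⟩

/-- `handleProj ∘ glueMapPT = pr₂ ∘ (radial retraction)`. [folklore] -/
theorem handleProj_comp_glueMapPT (ι : Type) [Unique ι] :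
    (handleProj ι k l).comp (glueMapPT ι k l) =
      (ContinuousMap.snd : C((𝕊 k) × (𝕊 l), 𝕊 l)).comp (tubeRetractionFun k l) := by
  ext q
  rfl

/-- The core sphere `v ↦ (0, v)` of the one-index handle. [folklore] -/
def coreSlice (ι : Type) [Unique ι] (k l : ℕ) : C(𝕊 l, ↥(ballTimesSphere ι k l)) :=
  ⟨fun v => ⟨(DiscreteIndex.mk default, ((0 : 𝔼 (k + 1)), v)), by simp⟩,
    Continuous.subtype_mk (continuous_const.prodMk (continuous_const.prodMk continuous_id)) _⟩

/-- **The handle `OD^{k+1} × Sˡ` deformation retracts onto its core sphere**: the projection to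
`Sˡ` is a homotopy equivalence with inverse the core slice and the straight-line homotopy
`(t, (y, v)) ↦ (t y, v)` in the disc (Hatcher 2002, Ch. 0). [cite: HatcherAT2002, Ch. 0 p. 4 and Cor. 2.11] -/
def handleEquiv (ι : Type) [Unique ι] (k l : ℕ) :
    ContinuousMap.HomotopyEquiv ↥(ballTimesSphere ι k l) (𝕊 l) where
  toFun := handleProj ι k l
  invFun := coreSlice ι k l
  left_inv := ⟨
    { toFun := fun p => ⟨(p.2.1.1, (((p.1 : ℝ)) • p.2.1.2.1, p.2.1.2.2)), by
        rw [mem_ballTimesSphere_iff, norm_smul, Real.norm_of_nonneg p.1.2.1]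
        calc (p.1 : ℝ) * ‖p.2.1.2.1‖ ≤ 1 * ‖p.2.1.2.1‖ := by gcongr; exact p.1.2.2
          _ < 1 := by rw [one_mul]; exact p.2.2⟩
      continuous_toFun := by
        refine Continuous.subtype_mk ((continuous_fst.comp (continuous_subtype_val.comp
          continuous_snd)).prodMk (Continuous.prodMk ?_ ?_)) _
        · exact (continuous_subtype_val.comp continuous_fst).smul
            (continuous_fst.comp (continuous_snd.comp (continuous_subtype_val.comp continuous_snd)))
        · exact continuous_snd.comp (continuous_snd.comp (continuous_subtype_val.comp continuous_snd))
      map_zero_left := fun b => by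
        apply Subtype.ext
        show (b.1.1, ((0 : ℝ) • b.1.2.1, b.1.2.2)) =
          (DiscreteIndex.mk default, ((0 : 𝔼 (k + 1)), b.1.2.2))
        rw [zero_smul, DiscreteIndex.eq_mk_default b.1.1]
      map_one_left := fun b => by
        apply Subtype.ext
        show (b.1.1, ((1 : ℝ) • b.1.2.1, b.1.2.2)) = b.1
        rw [one_smul] }⟩
  right_inv := by
    have h : (handleProj ι k l).comp (coreSlice ι k l) = ContinuousMap.id (𝕊 l) := by ext v; rfl
    rw [h]

/-- **The projection of the handle `OD^{k+1} × Sˡ → Sˡ` is an isomorphism on homology** (the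
handle deformation retracts onto its core sphere; Hatcher 2002, Cor. 2.11).
[cite: HatcherAT2002, Cor. 2.11] -/
theorem isIso_map_handleProj (ι : Type) [Unique ι] (j : ℕ) :
    IsIso (singularHomology.map ℤ ℤ (handleProj ι k l) j) :=
  isIso_map_homotopyEquiv_toFun (handleEquiv ι k l) j

/-- **Milnor's identification is an isomorphism on `Hₗ`** (`k ≠ l`, `k, l ≥ 2`): under
`φ(u, w) ∼ (‖w‖ u, w/‖w‖)` the meridian of the torus goes to the core sphere `0 × Sˡ` of the handle
(Kervaire–Milnor 1963, p. 516: "`ε' = ε'(1) ∈ HₖM₀` [is] the homology class corresponding to the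
meridian"). [cite: KervaireMilnorAnnals1963, Lemma 5.6, proof (p. 516)] -/
theorem isIso_map_glueMapPT (ι : Type) [Unique ι] (hk : 2 ≤ k) (hl : 2 ≤ l) (hkl : k ≠ l) :
    IsIso (singularHomology.map ℤ ℤ (glueMapPT ι k l) l) := by
  haveI := isIso_map_handleProj (k := k) (l := l) ι l
  haveI : IsIso (singularHomology.map ℤ ℤ (glueMapPT ι k l) l ≫
      singularHomology.map ℤ ℤ (handleProj ι k l) l) := by
    rw [← singularHomology.map_comp, handleProj_comp_glueMapPT]
    exact isIso_map_sndRadial hk hl hkl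
  exact IsIso.of_isIso_comp_right (singularHomology.map ℤ ℤ (glueMapPT ι k l) l)
    (singularHomology.map ℤ ℤ (handleProj ι k l) l)

end Tube

/-! ### Transport to the surgered space `P` -/

section Gluing

variable {EX HX : Type*} [NormedAddCommGroup EX] [NormedSpace ℝ EX] [TopologicalSpace HX]
  {IX : ModelWithCorners ℝ EX HX} {X : Type} [TopologicalSpace X] [ChartedSpace HX X] [T2Space X]
  {ι : Type} [Unique ι] {k l : ℕ} (ν : FramedSphereFamily IX X ι k (l + 1))
  {P : Type} [TopologicalSpace P] {jA : ↥ν.complement → P} {jB : ↥(ballTimesSphere ι k l) → P}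

/-- The punctured tube inside `X ∖ S`: `(u, w) ↦ φ(u, w)`. [folklore] -/
def tubeIncl : C(↥(puncturedUnitTube k l), ↥ν.complement) :=
  ⟨fun q => ⟨ν.toFun default q.1, ν.apply_mem_complement_of_mem default q.2⟩,
    ((ν.continuous default).comp continuous_subtype_val).subtype_mk _⟩

variable {ν}
variable (hA : IsOpenEmbedding jA) (hB : IsOpenEmbedding jB) (hcov : range jA ∪ range jB = univ)
  (hrel : ∀ a b, jA a = jB b ↔ sphereFamilySurgeryRel ν a b)

omit [TopologicalSpace P] in
include hrel in
/-- **The gluing square**: on the punctured tube, `jA ∘ φ = jB ∘` (Milnor's identification).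
[cite: MilnorHCobordism1965, Def. 3.11 (PDF p. 17)] -/
theorem jA_tubeIncl (q : ↥(puncturedUnitTube k l)) :
    jA (ν.tubeIncl q) = jB (glueMapPT ι k l q) := by
  refine (hrel _ _).2 ⟨q.1.1, ‖q.1.2‖, ⟨norm_pos_iff.2 q.2.1, q.2.2⟩, rfl, ?_⟩
  show ν.toFun default q.1 = ν.toFun (DiscreteIndex.mk.symm (DiscreteIndex.mk default))
    (q.1.1, ‖q.1.2‖ • (radialProjection (spherePt l) q.1.2 : 𝔼 (l + 1)))
  rw [norm_smul_coe_radialProjection]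
  rfl

omit [TopologicalSpace P] in
include hrel in
/-- `jA ∘ φ` maps the punctured tube into `range jA ∩ range jB`. [folklore] -/
theorem jA_tubeIncl_mem (q : ↥(puncturedUnitTube k l)) :
    jA (ν.tubeIncl q) ∈ range jA ∩ range jB :=
  ⟨mem_range_self _, ⟨glueMapPT ι k l q, (jA_tubeIncl hrel q).symm⟩⟩

include hA hrel in
/-- **The punctured tube is `range jA ∩ range jB`**: `q ↦ jA (φ q)` is a homeomorphism onto the
intersection of the two pieces of `P`. [folklore] -/
def tubeInterHomeomorph : ↥(puncturedUnitTube k l) ≃ₜ ↥(range jA ∩ range jB) :=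
  (ν.gluedPartHomeomorph.trans (hA.isEmbedding.homeomorphImage ν.gluedPart)).trans
    (Homeomorph.setCongr (range_inter_range_eq hrel).symm)

include hA hrel in
/-- The values of `tubeInterHomeomorph`. [folklore] -/
theorem tubeInterHomeomorph_apply_coe (q : ↥(puncturedUnitTube k l)) :
    ((tubeInterHomeomorph hA hrel q : ↥(range jA ∩ range jB)) : P) = jA (ν.tubeIncl q) := rfl

include hA hB hrel in
/-- **`Hₗ(jA(A) ∩ jB(B)) ≅ Hₗ(jB(B))`** for `k ≠ l`, `k, l ≥ 2`: the inclusion of the intersection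
of the two pieces of `P` into the handle piece is an isomorphism on `Hₗ` (transport of
`isIso_map_glueMapPT` along the gluing square). [cite: KervaireMilnorAnnals1963, Lemma 5.6, proof (p. 516)] -/
theorem isIso_map_inter_right (hk : 2 ≤ k) (hl : 2 ≤ l) (hkl : k ≠ l) :
    IsIso (singularHomology.map ℤ ℤ
      (subsetInclusion (inter_subset_right : range jA ∩ range jB ⊆ range jB)) l) := by
  haveI := isIso_map_glueMapPT (k := k) (l := l) ι hk hl hkl
  have hsq : ∀ q, hB.isEmbedding.toHomeomorph (glueMapPT ι k l q) =
      subsetInclusion (inter_subset_right : range jA ∩ range jB ⊆ range jB)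
        (tubeInterHomeomorph hA hrel q) := fun q => by
    apply Subtype.ext
    show jB (glueMapPT ι k l q) = jA (ν.tubeIncl q)
    rw [jA_tubeIncl hrel q]
  haveI hm : Mono (singularHomology.map ℤ ℤ
      (subsetInclusion (inter_subset_right : range jA ∩ range jB ⊆ range jB)) l) :=
    mono_map_of_conj ℤ ℤ (glueMapPT ι k l) _ (tubeInterHomeomorph hA hrel)
      hB.isEmbedding.toHomeomorph hsq l inferInstance
  haveI he : Epi (singularHomology.map ℤ ℤ
      (subsetInclusion (inter_subset_right : range jA ∩ range jB ⊆ range jB)) l) :=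
    epi_map_of_conj ℤ ℤ (glueMapPT ι k l) _ (tubeInterHomeomorph hA hrel)
      hB.isEmbedding.toHomeomorph hsq l inferInstance
  exact isIso_of_mono_of_epi _

/-! ### `Hₗ(P) = 0` for a surgery on a primitive middle-dimensional class -/

/-- **`Hₗ(X ∖ S) = 0` from `Hₗ(X) = 0` and the primitivity of `S`**: in the exact sequence of the
pair `Hₗ₊₁(X) → Hₗ₊₁(X, X ∖ S) → Hₗ(X ∖ S) → Hₗ(X)`, if the first map is onto and the last group
vanishes then `Hₗ(X ∖ S) = 0` — Kervaire–Milnor 1963, p. 516: "suppose that one chooses an element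
`λ ∈ HₖM` which is primitive in the sense that `μ·λ = 1` for some `μ`. It follows that … ", and
p. 527: "Since `μᵣ·λᵣ = 1` it follows that `Hₖ₋₁M₀ = 0`" (the map `HₖM → Hₖ(M, M₀) ≅ ℤ` being
`μ ↦ μ·λ`). [cite: KervaireMilnorAnnals1963, Lemma 5.6 (p. 516) and Lemma 7.1, proof (p. 527)] -/
theorem isZero_singularHomology_complement_of_epi
    (hX : IsZero (singularHomology ℤ ℤ X l))
    (hprim : Epi (relativeSingularHomology.ofAbsolute ℤ ℤ X (ν.complement : Set X) (l + 1))) :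
    IsZero (singularHomology ℤ ℤ ↥ν.complement l) := by
  have hδ : relativeSingularHomology.δ ℤ ℤ X (ν.complement : Set X) l = 0 := by
    rw [← cancel_epi (relativeSingularHomology.ofAbsolute ℤ ℤ X (ν.complement : Set X) (l + 1)),
      relativeSingularHomology.ofAbsolute_comp_δ, comp_zero]
  have hmono : Mono (singularHomology.map ℤ ℤ (subsetIncl (ν.complement : Set X)) l) :=
    (relativeSingularHomology.exact_δ_map ℤ ℤ (ν.complement : Set X) l).mono_g hδ
  exact hX.of_mono (singularHomology.map ℤ ℤ (subsetIncl (ν.complement : Set X)) l)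

include hA hB hcov hrel in
/-- **Surgery on a primitive middle-dimensional class keeps `Hₗ = 0`** (Kervaire–Milnor 1963,
Lemma 7.1, proof p. 527: "Since `μᵣ·λᵣ = 1` it follows that `Hₖ₋₁M₀ = 0`. From this fact one
easily proves that `M₀` and `M'` are `(k-1)`-connected"; Kosinski 1993, X.1, Prop. (1.3): a
surgery on a primitive class does not create homology one below). Let `P` be glued from `X ∖ S`
and the handle `OD^{k+1} × Sˡ` along a framed `k`-sphere `S` with fibre `ℝˡ⁺¹`, `k ≠ l`,
`2 ≤ l`, `l < k` (so in particular for the middle dimension `k = l + 1 ≥ 3` of a `2k`-manifold).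
If `Hₗ(X; ℤ) = 0` and `Hₗ₊₁(X; ℤ) → Hₗ₊₁(X, X ∖ S; ℤ)` is onto (primitivity of `[S]`), then
`Hₗ(P; ℤ) = 0`. Proof: `Hₗ(X ∖ S) = 0` (`isZero_singularHomology_complement_of_epi`); in the
Mayer–Vietoris sequence of `P = jA(X ∖ S) ∪ jB(OD × Sˡ)` the handle's `Hₗ` is the image of the
intersection (`isIso_map_inter_right`, the meridian), hence dies in `P` with that of `X ∖ S`
(`map_subsetIncl_right_eq_zero_of_epi`), and `Hₗ₋₁` of the intersection injects into
`Hₗ₋₁(X ∖ S)` (`mono_map_inter`, `l - 1 < min(k, l)`). [cite: KervaireMilnorAnnals1963, Lemma 7.1, proof (p. 527), with Lemma 5.6 (pp. 515–516)] [cite: Kosinski1993, Ch. X §1, Prop. (1.3)] -/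
theorem isZero_singularHomology_of_middleSurgery_of_epi (hl : 2 ≤ l) (hlk : l < k)
    (hX : IsZero (singularHomology ℤ ℤ X l))
    (hprim : Epi (relativeSingularHomology.ofAbsolute ℤ ℤ X (ν.complement : Set X) (l + 1))) :
    IsZero (singularHomology ℤ ℤ P l) := by
  obtain ⟨m, rfl⟩ : ∃ m, l = m + 1 := ⟨l - 1, by omega⟩
  -- `Hₗ(X ∖ S) = 0`, transported to `range jA`
  have hA0 : IsZero (singularHomology ℤ ℤ ↥(range jA) (m + 1)) :=
    ((isZero_singularHomology_complement_of_epi (ν := ν) hX hprim).of_iso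
      (singularHomology.mapIso ℤ ℤ hA.isEmbedding.toHomeomorph.symm (m + 1)))
  have hjU : singularHomology.map ℤ ℤ (subsetIncl (range jA)) (m + 1) = 0 := hA0.eq_of_src _ _
  -- the handle's `Hₗ` comes from the intersection (the meridian), hence dies in `P` too
  haveI := isIso_map_inter_right hA hB hrel (by omega) hl (by omega)
  have hjV : singularHomology.map ℤ ℤ (subsetIncl (range jB)) (m + 1) = 0 :=
    map_subsetIncl_right_eq_zero_of_epi (range jA) (range jB) m hjU inferInstance
  -- `Hₗ₋₁(U ∩ V) → Hₗ₋₁(U)` is injective below `min(k, l)`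
  have hmono := mono_map_inter ℤ ℤ hA hrel (m := m) (by omega) (by omega)
  exact isZero_of_mayerVietoris_of_map_eq_zero (range jA) (range jB) hA.isOpen_range
    hB.isOpen_range hcov m hjU hjV (mono_mayerVietoris_φ_of_mono_left _ _ m hmono)

end Gluing

end FramedSphereFamily

end Literature.Topology.FourManifolds

end
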